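import Summits.KontsevichZagierPeriods.KontsevichZagierPeriods.Theorems.HurwitzMicroSectorsNormalFormPrincipleAlgDlogMoves
import Summits.KontsevichZagierPeriods.KontsevichZagierPeriods.Theorems.AbelContractionRealHyperellipticSectorBudgetKit

/-!
# Route AbelContraction — `RealHyperellipticSector` (crux stmt-KontsevichZagierPeriods-12475):
# the dimension-certified port, layer 1 — dlog representations with real ALGEBRAIC data

Helper file of the line `Lines/birth.lean` (stub `stub_bakerAlg`, `--supports` the crux): the port
of `Theorems/HurwitzMicroSectorsNormalFormPrincipleAlgDlogMoves.lean` (namespace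
`…NormalFormPrinciple.PiBox.Dlog`) INTO THE BUDGET `KZ.relationsLE 1` — every statement
`… ∈ relations` of that file re-proved with the conclusion `… ∈ relationsLE 1`, each base move
carrying the certificate that all its representations have dimension `1` (rules 1b, 2), via the
budget kit `…RealHyperellipticSectorBudgetKit.lean` and `AbelContractionAbelContractionLemma.lean`:

* congruence / zero / merging (rule 1: `dlogA_congr_mem_relationsLE`, `dlogA_zero_mem_relationsLE`,
  `dlogA_merge_mem_relationsLE`);
* **scaling** by a real algebraic `s > 0` (rule 2, `dlogA_scale_mem_relationsLE`, registered
  sub-goal).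

The dimension-free lemmas of the original (`isSemialgebraic_setOf_apply_mem_Ioo_of_isAlgebraic`,
`exists_dlogA`, `value_dlogA`) are reused by importing it; names and hypotheses are those of the
original with `relations ↦ relationsLE`.

Sources: M. Kontsevich, D. Zagier, *Periods* (2001), §1.1–1.2 [KontsevichZagier2001].
No definitions are introduced.
-/

noncomputable section

open MeasureTheory Set
open Literature.NumberTheory.Transcendental Literature.NumberTheory.Transcendental.KZ
open Literature.ModelTheory.ExponentialFields (IsSemialgebraic)
open Summit.KontsevichZagierPeriods.AbelContraction.AbelContractionLemma
  (mem_relationsLE_of_integrandAdd of_mem_relationsLE_of_eqOn_zero)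

namespace Summit.KontsevichZagierPeriods.AbelContraction.RealHyperellipticSector.Port

namespace Dlog

open Summit.KontsevichZagierPeriods.KontsevichZagierPeriods.BetaCancellationLine
  (aff_hasFDerivAt_chart aff_abs_det_chartDeriv aff_injective_chart aff_isSemialgebraicMapOn_chart)

/-! ## The moves inside the budget -/

/-- Congruence of two representations on one slab with integrands `c/y` (inside the budget
`relationsLE 1`). [cite: KontsevichZagier2001, §1.2] -/
theorem dlogA_congr_mem_relationsLE {σ : Set (Fin 1 → ℝ)} {c : ℝ} (L L' : IntegralRep 1)
    (hd : L.domain = σ) (hd' : L'.domain = σ) (hi : EqOn L.integrand (fun x => c / x 0) L.domain)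
    (hi' : EqOn L'.integrand (fun x => c / x 0) L'.domain) : of L - of L' ∈ relationsLE 1 :=
  Budget.congr_mem_relationsLE le_rfl (hd'.trans hd.symm) fun x hx => by
    rw [hi hx, hi' (by rw [hd', ← hd]; exact hx)]

/-- Zero constant: `[σ, 0/y] ∈ relationsLE 1` (inside the budget `relationsLE 1`).
[cite: KontsevichZagier2001, §1.2] -/
theorem dlogA_zero_mem_relationsLE (L : IntegralRep 1)
    (hi : EqOn L.integrand (fun x => (0:ℝ) / x 0) L.domain) : of L ∈ relationsLE 1 :=
  of_mem_relationsLE_of_eqOn_zero le_rfl L fun x hx => by simp [hi hx]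

/-- Merging (rule 1b): `[σ, (c+c')/y] − [σ, c/y] − [σ, c'/y] ∈ relationsLE 1` (inside the budget
`relationsLE 1`). [cite: KontsevichZagier2001, §1.2 rule (1)] -/
theorem dlogA_merge_mem_relationsLE {σ : Set (Fin 1 → ℝ)} {c c' : ℝ} (L L₁ L₂ : IntegralRep 1)
    (hd : L.domain = σ) (hd₁ : L₁.domain = σ) (hd₂ : L₂.domain = σ)
    (hi : EqOn L.integrand (fun x => (c + c') / x 0) L.domain)
    (hi₁ : EqOn L₁.integrand (fun x => c / x 0) L₁.domain)
    (hi₂ : EqOn L₂.integrand (fun x => c' / x 0) L₂.domain) :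
    of L - of L₁ - of L₂ ∈ relationsLE 1 := by
  refine mem_relationsLE_of_integrandAdd le_rfl (hd₁.trans hd.symm) (hd₂.trans hd.symm)
    fun x hx => ?_
  rw [Pi.add_apply, hi hx, hi₁ (by rw [hd₁, ← hd]; exact hx), hi₂ (by rw [hd₂, ← hd]; exact hx)]
  ring

/-- **Scaling by an algebraic factor** (rule 2 among representations of dimension `1`)
(inside the budget `relationsLE 1`; registered sub-goal of crux stmt-KontsevichZagierPeriods-12475,
port of `PiBox.Dlog.dlogA_scale_mem_relations`): for real algebraic `s > 0` and `0 < a`,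
`[(a,b), c/y] − [(sa, sb), c/y] ∈ relationsLE 1` (dilation `y ↦ s y`, Jacobian `s`,
`c/y = (c/(sy))·s`). [cite: KontsevichZagier2001, §1.2 rule (2)] -/
theorem dlogA_scale_mem_relationsLE : ∀ {a b c s : ℝ}, IsAlgebraic ℚ s →
    ∀ (L L' : KZ.IntegralRep 1), L.domain = {x | x 0 ∈ Set.Ioo a b} →
    L'.domain = {x | x 0 ∈ Set.Ioo (s * a) (s * b)} →
    Set.EqOn L.integrand (fun x => c / x 0) L.domain →
    Set.EqOn L'.integrand (fun x => c / x 0) L'.domain → 0 < a → 0 < s →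
    KZ.of L - KZ.of L' ∈ KZ.relationsLE 1 := by
  intro a b c s hs L L' hd hd' hi hi' ha0 hs0
  have himage : L'.domain = (fun y : Fin 1 → ℝ => fun _ : Fin 1 => s * y 0 + 0) '' L.domain := by
    rw [hd, hd']
    ext y
    constructor
    · intro hy
      simp only [Set.mem_setOf_eq, Set.mem_Ioo] at hy
      refine ⟨fun _ => y 0 / s, ?_, ?_⟩
      · simp only [Set.mem_setOf_eq, Set.mem_Ioo]
        rw [lt_div_iff₀ hs0, div_lt_iff₀ hs0]
        constructor <;> nlinarith [hy.1, hy.2]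
      · funext i
        obtain rfl : i = 0 := Fin.fin_one_eq_zero i
        field_simp
        ring
    · rintro ⟨x, hx, rfl⟩
      simp only [Set.mem_setOf_eq, Set.mem_Ioo, add_zero] at hx ⊢
      exact ⟨mul_lt_mul_of_pos_left hx.1 hs0, mul_lt_mul_of_pos_left hx.2 hs0⟩
  refine Budget.changeOfVariables_mem_relationsLE le_rfl
    (fun y : Fin 1 → ℝ => fun _ : Fin 1 => s * y 0 + 0)
    (fun _ => s • ContinuousLinearMap.id ℝ (Fin 1 → ℝ))
    (aff_isSemialgebraicMapOn_chart L.isSemialgebraic_domain isAlgebraic_zero hs)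
    (fun x _ => (aff_hasFDerivAt_chart s 0 x).hasFDerivWithinAt)
    (aff_injective_chart hs0.ne' 0).injOn himage fun x hx => ?_
  have hΦx : (fun _ : Fin 1 => s * x 0 + 0) ∈ L'.domain := himage ▸ Set.mem_image_of_mem _ hx
  have hx0 : (0:ℝ) < x 0 := by rw [hd] at hx; exact lt_trans ha0 hx.1
  rw [hi hx, hi' hΦx, aff_abs_det_chartDeriv hs0]
  simp only [add_zero]
  field_simp

end Dlog

end Summit.KontsevichZagierPeriods.AbelContraction.RealHyperellipticSector.Port

end
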